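import Summits.AnomalousDissipation.AnomalousDissipation.Theorems.SolenoidalFractalHomogenisationLagrangianStepCellLawVQSOddEvenKernel
import Summits.AnomalousDissipation.AnomalousDissipation.Theorems.SolenoidalFractalHomogenisationLagrangianStepCellLawVQSSpectral
import Literature.Analysis.FluidPDE.QuasiStaticSlotWeightClosedForm
import HarnessLib

/-!
# K1L `LagrangianRenormalisationStep(Design)` (K1L_D, stmt-AnomalousDissipation-27980), stub `stub_cellLawV0_IS`, obligation `stub_D1_exactFamily`
# clause (i) — the PAIR MEMORY of two colinear adjacent slots at the block level (helper; `--supports … --as helper`; word-independent)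

Summits-side helper file of route `SolenoidalFractalHomogenisation` (prover seat `ad-sawtooth-k1loc-p1` g12; brick B1 of the sizing memo
`HOME/ad-sawtooth-k1loc-p1/D1i-sizing-k1locp1g12.md`, finding F-p1g12-1).  In the exact family `Sideband.psiStar` (D26-3) the only memory term of the
period-mean feedback above `e^{−Tb}` is the leftover corrector of the first slot of a colinear adjacent polarisation pair read during the second slot:
with the unit trapezoid envelope `a` (ramp `ρ`), relaxation `T`, common transverse block `B`, and polarisation vectors `v, w`, it is the bilinear form
`P_T(B; v, w) = T ∫₀¹ a(s) ∫₀¹ a(x) · vᵀ e^{−T(1+s−x)B} w dx ds` (second-slot pickup `s`, first-slot injection `x`).  This file proves: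
* `trapezoid_one_symm` (`a(1−x) = a(x)`), `laplace_trapezoid_eq` — the closed form **`∫₀¹ a(x)e^{−cx}dx = (1 − e^{−cρ} − e^{−c(1−ρ)} + e^{−c})/(ρc²)`**
  (`c > 0`; from `duhamel_trapezoid_at_end` by the symmetry), `laplace_trapezoid_le` (`≤ 1/(ρc²)`), `laplace_trapezoid_nonneg`;
* **`pairForm_eq_sum_eig`** — for SYMMETRIC `B` with an orthonormal eigenbasis `(q_k, β_k)`: `P_T(B; v, w) = T Σ_k K(Tβ_k)² (q_k·v)(q_k·w)`, `K(c) = ∫₀¹ a e^{−c·}`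
  (spectral representation `sum_mul_exp_neg_smul_mulVec_eq_sum_eig`, p679315): the pair term is the matrix function `T·K(TB)²`, per eigenvalue
  `T·K(Tβ)² ≈ 4/(T³β⁴)` against the slot response `f_T(β) ≈ ϑ_∞/β` — ratio `≈ 12/(T³β³)` (`≈ 4·10⁻⁴` at `T = 31.6`, `10⁻⁶` at `T = 202`);
* **`abs_pairForm_le`** — for an ARBITRARY block with `b|y|² ≤ yᵀBy` (`b > 0`): `|P_T(B; v, w)| ≤ T·K(Tb)²·|v||w| ≤ |v||w|/(ρ²T³b⁴)` (energy decay of the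
  semigroup, Cauchy–Schwarz) — the crude bound, sufficient for the {110}/{111} pairs and the sectorial perturbation of the pair term.
Everything PROVED, no definition, no named fact, no sorry.  Infrastructure for rung leaf F-D1.A0; NOT a proof of the stub, of the crux, of Onsager's
conjecture or of anomalous dissipation.
-/

set_option linter.dupNamespace false

noncomputable section

namespace Summit.AnomalousDissipation.AnomalousDissipation.Theorems.SolenoidalFractalHomogenisation.LagrangianStep

open Literature.Analysis Literature.Analysis.FluidPDE Literature.Analysis.FunctionSpaces
open Literature.Analysis.ODE.PeriodicAveraging
open MeasureTheory Set Real Matrix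

/-! ## §1 The Laplace transform of the unit trapezoid -/

section Laplace

/-- The unit trapezoid is symmetric about `1/2`: `a(1 − x) = a(x)`. [folklore] -/
theorem trapezoid_one_symm (ρ x : ℝ) :
    LatticeShear.LatticeWord.trapezoid 0 1 ρ (1 - x) = LatticeShear.LatticeWord.trapezoid 0 1 ρ x := by
  unfold LatticeShear.LatticeWord.trapezoid
  rw [min_comm ((1 - x - 0) / (ρ * 1)) ((0 + 1 - (1 - x)) / (ρ * 1))]
  congr 3 <;> ring

/-- **Closed form of the trapezoid's Laplace transform** (`0 < ρ ≤ 1/2`, `c > 0`):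
`∫₀¹ a(x) e^{−cx} dx = (1 − e^{−cρ} − e^{−c(1−ρ)} + e^{−c})/(ρc²)` (the end value `J(1)` of the Duhamel response, by the symmetry `a(1−x) = a(x)`).
[cite: MajdaKramer1999, §2.2.1.3 (55)] -/
theorem laplace_trapezoid_eq {ρ c : ℝ} (hρ : 0 < ρ) (hρ2 : ρ ≤ 1 / 2) (hc : 0 < c) :
    ∫ x in (0:ℝ)..1, LatticeShear.LatticeWord.trapezoid 0 1 ρ x * Real.exp (-(c * x))
      = (1 - Real.exp (-(c * ρ)) - Real.exp (-(c * (1 - ρ))) + Real.exp (-c)) / (ρ * c ^ 2) := by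
  rw [← LatticeShear.duhamel_trapezoid_at_end hρ hρ2 hc, ← intervalIntegral.integral_const_mul]
  -- substitute `x ↦ 1 − x`
  have hsub : ∫ x in (0:ℝ)..1, LatticeShear.LatticeWord.trapezoid 0 1 ρ x * Real.exp (-(c * x))
      = ∫ x in (0:ℝ)..1, LatticeShear.LatticeWord.trapezoid 0 1 ρ (1 - x) * Real.exp (-(c * (1 - x))) := by
    have h := intervalIntegral.integral_comp_sub_left
      (fun x => LatticeShear.LatticeWord.trapezoid 0 1 ρ x * Real.exp (-(c * x))) (1:ℝ) (a := 0) (b := 1)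
    simp only [sub_self, sub_zero] at h
    rw [h]
  rw [hsub]
  refine intervalIntegral.integral_congr fun x _ => ?_
  simp only [trapezoid_one_symm]
  rw [show Real.exp (-(c * (1 - x))) = Real.exp (c * x) * Real.exp (-c * 1) by rw [← Real.exp_add]; congr 1; ring]
  ring

/-- The Laplace transform of the trapezoid is non-negative. [folklore] -/
theorem laplace_trapezoid_nonneg (ρ c : ℝ) :
    0 ≤ ∫ x in (0:ℝ)..1, LatticeShear.LatticeWord.trapezoid 0 1 ρ x * Real.exp (-(c * x)) :=
  intervalIntegral.integral_nonneg zero_le_one fun x _ => mul_nonneg (trapezoid_unit_nonneg ρ x) (Real.exp_pos _).le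

/-- Crude bound: `∫₀¹ a(x)e^{−cx}dx ≤ 1/(ρc²)` (`ρ, c > 0`). [cite: MajdaKramer1999, §2.2.1.3 (55)] -/
theorem laplace_trapezoid_le {ρ c : ℝ} (hρ : 0 < ρ) (hc : 0 < c) :
    ∫ x in (0:ℝ)..1, LatticeShear.LatticeWord.trapezoid 0 1 ρ x * Real.exp (-(c * x)) ≤ 1 / (ρ * c ^ 2) := by
  have h := LatticeShear.integral_trapezoid_mul_exp_neg_le (τ := 1) one_pos hρ hc
  simp only [mul_one] at h
  refine le_trans (le_of_eq (intervalIntegral.integral_congr fun x _ => ?_)) h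
  show LatticeShear.LatticeWord.trapezoid 0 1 ρ x * Real.exp (-(c * x)) = LatticeShear.LatticeWord.trapezoid 0 1 ρ x * Real.exp (-c * x)
  rw [neg_mul]

/-- The Laplace transform of the trapezoid is antitone in the rate. [folklore] -/
theorem laplace_trapezoid_antitone (ρ : ℝ) {c c' : ℝ} (hcc' : c ≤ c') :
    ∫ x in (0:ℝ)..1, LatticeShear.LatticeWord.trapezoid 0 1 ρ x * Real.exp (-(c' * x))
      ≤ ∫ x in (0:ℝ)..1, LatticeShear.LatticeWord.trapezoid 0 1 ρ x * Real.exp (-(c * x)) := by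
  refine intervalIntegral.integral_mono_on zero_le_one ?_ ?_ fun x hx => ?_
  · exact ((continuous_trapezoid_unit ρ).mul (by fun_prop)).intervalIntegrable _ _
  · exact ((continuous_trapezoid_unit ρ).mul (by fun_prop)).intervalIntegrable _ _
  · exact mul_le_mul_of_nonneg_left (Real.exp_le_exp.2 (by nlinarith [hx.1])) (trapezoid_unit_nonneg ρ x)

end Laplace

/-! ## §2 The pair form on an eigenbasis (symmetric block) -/

section Pair

variable {m : ℕ}

/-- Finite sums with continuous terms commute with the interval integral against a continuous weight. [folklore] -/
private theorem integral_mul_sum' {ι : Type*} (t : Finset ι) {α : ℝ → ℝ} {g : ι → ℝ → ℝ} (hα : Continuous α)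
    (hg : ∀ k ∈ t, Continuous (g k)) (x y : ℝ) :
    ∫ s in x..y, α s * ∑ k ∈ t, g k s = ∑ k ∈ t, ∫ s in x..y, α s * g k s := by
  rw [← intervalIntegral.integral_finsetSum]
  · refine intervalIntegral.integral_congr fun s _ => ?_
    simp only [Finset.mul_sum]
  · exact fun k hk => (hα.mul (hg k hk)).intervalIntegrable _ _

/-- **The pair memory on an eigenbasis.**  For a real symmetric `B` with an orthonormal eigenbasis `(q_k, β_k)`:
`T∫₀¹ a(s) ∫₀¹ a(x) vᵀe^{−T(1+s−x)B}w dx ds = T Σ_k (∫₀¹ a e^{−Tβ_k s})(∫₀¹ a(x) e^{−Tβ_k(1−x)}) (q_k·v)(q_k·w)`. [folklore] -/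
theorem pairForm_eq_sum_eig' {B : Matrix (Fin m) (Fin m) ℝ} (hB : B.IsSymm)
    (q : OrthonormalBasis (Fin m) ℝ (EuclideanSpace ℝ (Fin m))) (β : Fin m → ℝ)
    (hq : ∀ k, B.mulVec (q k) = β k • ⇑(q k)) (ρ T : ℝ) (v w : Fin m → ℝ) :
    T * ∫ s in (0:ℝ)..1, LatticeShear.LatticeWord.trapezoid 0 1 ρ s *
        ∫ x in (0:ℝ)..1, LatticeShear.LatticeWord.trapezoid 0 1 ρ x *
          ∑ i, v i * (NormedSpace.exp (-((T * (1 + s - x)) • B))).mulVec w i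
      = T * ∑ k, ((∫ s in (0:ℝ)..1, LatticeShear.LatticeWord.trapezoid 0 1 ρ s * Real.exp (-(T * β k * s)))
          * (∫ x in (0:ℝ)..1, LatticeShear.LatticeWord.trapezoid 0 1 ρ x * Real.exp (-(T * β k * (1 - x))))
          * ((∑ i, q k i * v i) * (∑ i, q k i * w i))) := by
  have hαc : Continuous fun s : ℝ => LatticeShear.LatticeWord.trapezoid 0 1 ρ s := continuous_trapezoid_unit ρ
  congr 1
  -- the kernel on the eigenbasis, factorised in `s` and `x`
  have hker : ∀ s x : ℝ, ∑ i, v i * (NormedSpace.exp (-((T * (1 + s - x)) • B))).mulVec w i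
      = ∑ k, (Real.exp (-(T * β k * s)) * ((∑ i, q k i * v i) * (∑ i, q k i * w i))) * Real.exp (-(T * β k * (1 - x))) := by
    intro s x
    rw [sum_mul_exp_neg_smul_mulVec_eq_sum_eig hB q β hq v w]
    refine Finset.sum_congr rfl fun k _ => ?_
    rw [show Real.exp (-(β k * (T * (1 + s - x)))) = Real.exp (-(T * β k * s)) * Real.exp (-(T * β k * (1 - x))) by
      rw [← Real.exp_add]; congr 1; ring]
    ring
  -- inner integral
  have hinner : ∀ s, ∫ x in (0:ℝ)..1, LatticeShear.LatticeWord.trapezoid 0 1 ρ x *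
        ∑ i, v i * (NormedSpace.exp (-((T * (1 + s - x)) • B))).mulVec w i
      = ∑ k, (Real.exp (-(T * β k * s)) * ((∑ i, q k i * v i) * (∑ i, q k i * w i))) *
          ∫ x in (0:ℝ)..1, LatticeShear.LatticeWord.trapezoid 0 1 ρ x * Real.exp (-(T * β k * (1 - x))) := by
    intro s
    simp only [hker]
    rw [integral_mul_sum' Finset.univ (g := fun k x => (Real.exp (-(T * β k * s)) * ((∑ i, q k i * v i) * (∑ i, q k i * w i)))
      * Real.exp (-(T * β k * (1 - x)))) hαc (fun k _ => by fun_prop) 0 1]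
    refine Finset.sum_congr rfl fun k _ => ?_
    rw [← intervalIntegral.integral_const_mul]
    refine intervalIntegral.integral_congr fun x _ => ?_
    ring
  simp only [hinner]
  rw [integral_mul_sum' Finset.univ
    (g := fun k s => (Real.exp (-(T * β k * s)) * ((∑ i, q k i * v i) * (∑ i, q k i * w i)))
      * ∫ x in (0:ℝ)..1, LatticeShear.LatticeWord.trapezoid 0 1 ρ x * Real.exp (-(T * β k * (1 - x)))) hαc
    (fun k _ => by fun_prop) 0 1]
  refine Finset.sum_congr rfl fun k _ => ?_
  rw [← intervalIntegral.integral_mul_const, ← intervalIntegral.integral_mul_const]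
  refine intervalIntegral.integral_congr fun s _ => ?_
  ring

/-- **The pair memory is the matrix function `T·K(TB)²`**: same statement with the second factor rewritten by the symmetry `a(1−x) = a(x)`:
`… = T Σ_k K(Tβ_k)² (q_k·v)(q_k·w)`, `K(c) = ∫₀¹ a(x)e^{−cx}dx`. [folklore] -/
theorem pairForm_eq_sum_eig {B : Matrix (Fin m) (Fin m) ℝ} (hB : B.IsSymm)
    (q : OrthonormalBasis (Fin m) ℝ (EuclideanSpace ℝ (Fin m))) (β : Fin m → ℝ)
    (hq : ∀ k, B.mulVec (q k) = β k • ⇑(q k)) (ρ T : ℝ) (v w : Fin m → ℝ) :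
    T * ∫ s in (0:ℝ)..1, LatticeShear.LatticeWord.trapezoid 0 1 ρ s *
        ∫ x in (0:ℝ)..1, LatticeShear.LatticeWord.trapezoid 0 1 ρ x *
          ∑ i, v i * (NormedSpace.exp (-((T * (1 + s - x)) • B))).mulVec w i
      = T * ∑ k, (∫ s in (0:ℝ)..1, LatticeShear.LatticeWord.trapezoid 0 1 ρ s * Real.exp (-(T * β k * s))) ^ 2
          * ((∑ i, q k i * v i) * (∑ i, q k i * w i)) := by
  rw [pairForm_eq_sum_eig' hB q β hq ρ T v w]
  congr 1
  refine Finset.sum_congr rfl fun k _ => ?_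
  have hsymm : ∫ x in (0:ℝ)..1, LatticeShear.LatticeWord.trapezoid 0 1 ρ x * Real.exp (-(T * β k * (1 - x)))
      = ∫ x in (0:ℝ)..1, LatticeShear.LatticeWord.trapezoid 0 1 ρ x * Real.exp (-(T * β k * x)) := by
    have h := intervalIntegral.integral_comp_sub_left
      (fun x => LatticeShear.LatticeWord.trapezoid 0 1 ρ x * Real.exp (-(T * β k * x))) (1:ℝ) (a := 0) (b := 1)
    simp only [sub_self, sub_zero] at h
    rw [← h]
    refine intervalIntegral.integral_congr fun x _ => ?_
    simp only [trapezoid_one_symm]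
  rw [hsymm, sq]

end Pair

/-! ## §3 The crude bound for an arbitrary coercive block -/

section Crude

variable {m : ℕ}

/-- Energy bound of the kernel: `|vᵀe^{−τB}w| ≤ e^{−bτ}|v||w|` for `b|y|² ≤ yᵀBy`, `τ ≥ 0` (no symmetry). [folklore] -/
theorem abs_form_exp_le_of_coercive (B : Matrix (Fin m) (Fin m) ℝ) {b : ℝ}
    (hb : ∀ y : Fin m → ℝ, b * ∑ i, y i ^ 2 ≤ ∑ i, ∑ j, y i * B i j * y j) (v w : Fin m → ℝ) {τ : ℝ} (hτ : 0 ≤ τ) :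
    |∑ i, v i * (NormedSpace.exp (-(τ • B))).mulVec w i|
      ≤ Real.exp (-(b * τ)) * (Real.sqrt (∑ i, v i ^ 2) * Real.sqrt (∑ i, w i ^ 2)) := by
  set u := (NormedSpace.exp (-(τ • B))).mulVec w with hu
  have hdec : Real.sqrt (∑ i, u i ^ 2) ≤ Real.exp (-(b * τ)) * Real.sqrt (∑ i, w i ^ 2) :=
    (sqrt_sum_sq_orbit_le B w hb hτ).1
  have hcs := sum_mul_le_sqrt_mul_sqrt v u
  have hcs' := sum_mul_le_sqrt_mul_sqrt (fun i => -v i) u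
  have e1 : ∑ i, (-v i) ^ 2 = ∑ i, v i ^ 2 := Finset.sum_congr rfl fun i _ => by ring
  have e2 : ∑ i, -v i * u i = -∑ i, v i * u i := by
    rw [← Finset.sum_neg_distrib]; exact Finset.sum_congr rfl fun i _ => by ring
  rw [e1, e2] at hcs'
  have hV := Real.sqrt_nonneg (∑ i, v i ^ 2)
  have hprod : Real.sqrt (∑ i, v i ^ 2) * Real.sqrt (∑ i, u i ^ 2)
      ≤ Real.exp (-(b * τ)) * (Real.sqrt (∑ i, v i ^ 2) * Real.sqrt (∑ i, w i ^ 2)) := by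
    calc Real.sqrt (∑ i, v i ^ 2) * Real.sqrt (∑ i, u i ^ 2) ≤ Real.sqrt (∑ i, v i ^ 2) * (Real.exp (-(b * τ)) * Real.sqrt (∑ i, w i ^ 2)) :=
          mul_le_mul_of_nonneg_left hdec hV
      _ = _ := by ring
  rw [abs_le]
  constructor <;> linarith

/-- **Crude bound of the pair memory** for an arbitrary block with `b|y|² ≤ yᵀBy`, `b > 0`, `T > 0`, `0 < ρ`:
`|T∫₀¹a(s)∫₀¹a(x) vᵀe^{−T(1+s−x)B}w| ≤ T·K(Tb)²·|v||w|` with `K(c) = ∫₀¹a e^{−c·}`. [folklore] -/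
theorem abs_pairForm_le (B : Matrix (Fin m) (Fin m) ℝ) {b ρ T : ℝ} (hT : 0 < T)
    (hb : ∀ y : Fin m → ℝ, b * ∑ i, y i ^ 2 ≤ ∑ i, ∑ j, y i * B i j * y j) (v w : Fin m → ℝ) :
    |T * ∫ s in (0:ℝ)..1, LatticeShear.LatticeWord.trapezoid 0 1 ρ s *
        ∫ x in (0:ℝ)..1, LatticeShear.LatticeWord.trapezoid 0 1 ρ x *
          ∑ i, v i * (NormedSpace.exp (-((T * (1 + s - x)) • B))).mulVec w i|
      ≤ T * (∫ s in (0:ℝ)..1, LatticeShear.LatticeWord.trapezoid 0 1 ρ s * Real.exp (-(T * b * s))) ^ 2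
          * (Real.sqrt (∑ i, v i ^ 2) * Real.sqrt (∑ i, w i ^ 2)) := by
  set α : ℝ → ℝ := fun s => LatticeShear.LatticeWord.trapezoid 0 1 ρ s with hα
  have hαc : Continuous α := continuous_trapezoid_unit ρ
  set VW := Real.sqrt (∑ i, v i ^ 2) * Real.sqrt (∑ i, w i ^ 2) with hVW
  have hVW0 : 0 ≤ VW := by positivity
  set Kb := ∫ s in (0:ℝ)..1, α s * Real.exp (-(T * b * s)) with hKb
  have hKb0 : 0 ≤ Kb := laplace_trapezoid_nonneg ρ (T * b)
  -- continuity of the kernel form in `(s, x)`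
  have hF : Continuous fun p : ℝ × ℝ => ∑ i, v i * (NormedSpace.exp (-((T * (1 + p.1 - p.2)) • B))).mulVec w i := by
    have h : ∀ i, Continuous fun p : ℝ × ℝ => (NormedSpace.exp (-((T * (1 + p.1 - p.2)) • B))).mulVec w i := fun i =>
      ((continuous_apply i).comp (continuous_exp_neg_smul_mulVec B w)).comp (by fun_prop)
    exact continuous_finsetSum _ fun i _ => continuous_const.mul (h i)
  -- pointwise kernel bound on the square
  have hpt : ∀ s x : ℝ, 0 ≤ s → x ≤ 1 →
      |∑ i, v i * (NormedSpace.exp (-((T * (1 + s - x)) • B))).mulVec w i|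
        ≤ Real.exp (-(T * b * s)) * Real.exp (-(T * b * (1 - x))) * VW := by
    intro s x hs hx
    have hτ : 0 ≤ T * (1 + s - x) := mul_nonneg hT.le (by linarith)
    have h := abs_form_exp_le_of_coercive B hb v w hτ
    have he : Real.exp (-(b * (T * (1 + s - x)))) = Real.exp (-(T * b * s)) * Real.exp (-(T * b * (1 - x))) := by
      rw [← Real.exp_add]; congr 1; ring
    rwa [he] at h
  -- inner integral bound
  have hinner : ∀ s, 0 ≤ s → |∫ x in (0:ℝ)..1, α x * ∑ i, v i * (NormedSpace.exp (-((T * (1 + s - x)) • B))).mulVec w i|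
      ≤ Real.exp (-(T * b * s)) * Kb * VW := by
    intro s hs
    have h1 : |∫ x in (0:ℝ)..1, α x * ∑ i, v i * (NormedSpace.exp (-((T * (1 + s - x)) • B))).mulVec w i|
        ≤ ∫ x in (0:ℝ)..1, α x * (Real.exp (-(T * b * s)) * Real.exp (-(T * b * (1 - x))) * VW) := by
      rw [← Real.norm_eq_abs]
      refine intervalIntegral.norm_integral_le_of_norm_le zero_le_one (Filter.Eventually.of_forall fun x hx => ?_) ?_
      · rw [Real.norm_eq_abs, abs_mul, abs_of_nonneg (trapezoid_unit_nonneg ρ x)]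
        exact mul_le_mul_of_nonneg_left (hpt s x hs hx.2) (trapezoid_unit_nonneg ρ x)
      · exact (hαc.mul (by fun_prop)).intervalIntegrable _ _
    refine h1.trans (le_of_eq ?_)
    have hsymm : ∫ x in (0:ℝ)..1, α x * Real.exp (-(T * b * (1 - x))) = Kb := by
      have h := intervalIntegral.integral_comp_sub_left (fun x => α x * Real.exp (-(T * b * x))) (1:ℝ) (a := 0) (b := 1)
      simp only [sub_self, sub_zero] at h
      rw [hKb, ← h]
      refine intervalIntegral.integral_congr fun x _ => ?_
      simp only [hα, trapezoid_one_symm]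
    rw [← hsymm, ← intervalIntegral.integral_const_mul, ← intervalIntegral.integral_mul_const]
    refine intervalIntegral.integral_congr fun x _ => ?_
    ring
  -- outer integral
  have hJc : Continuous fun s => α s * ∫ x in (0:ℝ)..1, α x * ∑ i, v i * (NormedSpace.exp (-((T * (1 + s - x)) • B))).mulVec w i := by
    have hf : Continuous (Function.uncurry fun s x : ℝ => α x * ∑ i, v i * (NormedSpace.exp (-((T * (1 + s - x)) • B))).mulVec w i) :=
      (hαc.comp continuous_snd).mul hF
    exact hαc.mul (intervalIntegral.continuous_parametric_intervalIntegral_of_continuous' hf 0 1)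
  have h3 : |∫ s in (0:ℝ)..1, α s * ∫ x in (0:ℝ)..1, α x * ∑ i, v i * (NormedSpace.exp (-((T * (1 + s - x)) • B))).mulVec w i|
      ≤ ∫ s in (0:ℝ)..1, α s * Real.exp (-(T * b * s)) * (Kb * VW) := by
    rw [← Real.norm_eq_abs]
    refine intervalIntegral.norm_integral_le_of_norm_le zero_le_one (Filter.Eventually.of_forall fun s hs => ?_) ?_
    · rw [Real.norm_eq_abs, abs_mul, abs_of_nonneg (trapezoid_unit_nonneg ρ s)]
      calc α s * |∫ x in (0:ℝ)..1, α x * ∑ i, v i * (NormedSpace.exp (-((T * (1 + s - x)) • B))).mulVec w i|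
          ≤ α s * (Real.exp (-(T * b * s)) * Kb * VW) := mul_le_mul_of_nonneg_left (hinner s hs.1.le) (trapezoid_unit_nonneg ρ s)
        _ = _ := by ring
    · exact ((hαc.mul (by fun_prop)).mul continuous_const).intervalIntegrable _ _
  rw [intervalIntegral.integral_mul_const] at h3
  rw [abs_mul, abs_of_pos hT]
  calc T * |∫ s in (0:ℝ)..1, α s * ∫ x in (0:ℝ)..1, α x * ∑ i, v i * (NormedSpace.exp (-((T * (1 + s - x)) • B))).mulVec w i|
      ≤ T * ((∫ s in (0:ℝ)..1, α s * Real.exp (-(T * b * s))) * (Kb * VW)) := mul_le_mul_of_nonneg_left h3 hT.le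
    _ = T * Kb ^ 2 * VW := by rw [hKb]; ring

/-- **The crude pair-memory constant**: with `b|y|² ≤ yᵀBy`, `b, T, ρ > 0`, the pair form is at most `|v||w|/(ρ²T³b⁴)`. [folklore] -/
theorem abs_pairForm_le' (B : Matrix (Fin m) (Fin m) ℝ) {b ρ T : ℝ} (hb0 : 0 < b) (hρ : 0 < ρ) (hT : 0 < T)
    (hb : ∀ y : Fin m → ℝ, b * ∑ i, y i ^ 2 ≤ ∑ i, ∑ j, y i * B i j * y j) (v w : Fin m → ℝ) :
    |T * ∫ s in (0:ℝ)..1, LatticeShear.LatticeWord.trapezoid 0 1 ρ s *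
        ∫ x in (0:ℝ)..1, LatticeShear.LatticeWord.trapezoid 0 1 ρ x *
          ∑ i, v i * (NormedSpace.exp (-((T * (1 + s - x)) • B))).mulVec w i|
      ≤ 1 / (ρ ^ 2 * T ^ 3 * b ^ 4) * (Real.sqrt (∑ i, v i ^ 2) * Real.sqrt (∑ i, w i ^ 2)) := by
  refine (abs_pairForm_le B hT hb v w).trans ?_
  have hK := laplace_trapezoid_le hρ (mul_pos hT hb0)
  have hK0 := laplace_trapezoid_nonneg ρ (T * b)
  have hVW : 0 ≤ Real.sqrt (∑ i, v i ^ 2) * Real.sqrt (∑ i, w i ^ 2) := by positivity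
  refine mul_le_mul_of_nonneg_right ?_ hVW
  calc T * (∫ s in (0:ℝ)..1, LatticeShear.LatticeWord.trapezoid 0 1 ρ s * Real.exp (-(T * b * s))) ^ 2
      ≤ T * (1 / (ρ * (T * b) ^ 2)) ^ 2 := by gcongr
    _ = 1 / (ρ ^ 2 * T ^ 3 * b ^ 4) := by field_simp

end Crude

end Summit.AnomalousDissipation.AnomalousDissipation.Theorems.SolenoidalFractalHomogenisation.LagrangianStep
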